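import Summits.QuantumFields.YangMills.Theorems.IR.Negative.TypShellCondUKPcFalseOfWildWire
import Summits.QuantumFields.YangMills.Theorems.BalabanLadderIRTypLocalExcessMeas
import Summits.QuantumFields.YangMills.Theorems.BalabanLadderIRHereditaryUpgrade
import HarnessLib

/-!
# Line `af-pincer-Uc` (crux `IR`, stmt-QuantumFields-19354): the SUPPLIER ADAPTER for `stub_onsetUc` — format Uc from
# clause (i) at the centre + single-cell any-exterior rarity, for frame-covariant classes; the working class packaged;
# the onset statement `OnsetMixingTypicalUKPc` reduced to «(i) + (A′)»

Helper module for item `stmt-QuantumFields-19354` (`--supports`; it closes nothing).  Slot of record «af-pincer-Uc»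
(`pub/ym-beyond/p2-g28-files/line-af-pincer-Uc.reg.lean` b6e69d9662b5b07a).  Its format clauses have ONE tree copy each
(route owner ruling R76 FIX-B): `OnsetFormatsUc.IsFrame` / `TypLocal` / `ClauseIAll` / `ClauseIIukp` / `ClauseIII` /
`TypShellCondUKPc` / `OnsetMixingTypicalUKPc` (`Theorems/IR/Negative/TypShellCondUKPcFalseOfWildWire`, verbatim mirrors of
the slot :174–223, :266) and `FixedMesh.ClauseI` (`Theorems/IR/Negative/FixedMesh/ClauseI`, = slot :186–195 verbatim); the
slot's own format module `Theorems/IR/AfPincerUcFormat` (seat ym-19354-afpincer-s1) re-exports exactly these.  This file is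
written against those TREE constants, so its conclusions are the slot's clauses BY NAME up to the owner's aliasing.

PROVENANCE.  §1–§4 are the crux-plan seat's supplier adapters (`ym-cplan-19354-af-pincer`, `Sketch-g7-supplier-Uc.lean`
5b30fcf11d7560f0 §B–§C: «ARCH-AE re-targeted to U^c», all PROVED there against a verbatim mirror of the slot), ported by the
line's lead prover onto the tree constants; `FrameCovariant` / `diluteTyp_shiftFrame` / `WorkingClass` are the tree's
(`Theorems/BalabanLadderIRTypLocalExcessMeas`).  §5–§6 are the lead's packaging: the working class
`WorkingClass = diluteTyp ∩ Typ_lx^int` meets the adapter's side conditions, and the REDUCTION OF RECORD for the stub: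

  `OnsetMixingTypicalUKPc ⇐ ClauseIAndRarityAtOnset`                                     (`onsetMixingTypicalUKPc_of_clauseI_supCellRarity`)

where the hypothesis asks, for every compact simple `G` and lattice representation `r`, for admissible `(n, ε)` and, for
every budget `δ > 0` and all large `β`, SOME mesh `b ≥ 1` and SOME frame-covariant cell-local measurable family with
(a) single-cell ANY-EXTERIOR rarity `≤ δ` (`SupCellRarityAt`) and (b) clause (i) AT THE CENTRE on every mesh-`b` frame.
The two tree upgrades `IRRarityUpgrade.supJointRarity_of_supCellRarity` ((ii) in UKP form, product `δ^#F`, any exterior)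
and `torusJointRarity_of_supCellRarity` ((iii), the torus anchor) supply the other clauses; covariance makes (i) at every
centre (`ClauseIAll`) equal to (i) at the centre on every frame (`clauseIAll_of_covariant`).

WHAT THIS SAYS ABOUT THE STUB (honest): (a) is an energy–entropy statement per cell, deliverable for the working class from
tree bounds (`supCellRarity_diluteTyp`, the per-ball kernel energy gap of `…IRKernelLargeField`'s sequel) — §4 records the
dilute tier's instance; (b) — sub-region mixing at the centre cell at a β-DEPENDENT mesh `b(β) → ∞` (fixed mesh is refuted in
kernel: `Theorems/IR/Negative/TypShellCondFalseFixedMesh`), uniformly over typical frozen data — is the crux's research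
content and is NOT claimed anywhere in this file.  Conditional chain above the crux untouched; not a gap, not Clay.
All declarations proved (no `sorry`); axioms ⊆ {propext, Classical.choice, Quot.sound}.
-/

set_option autoImplicit false

noncomputable section

open Filter Topology MeasureTheory
open scoped Matrix.Norms.Frobenius
open Literature.MathematicalPhysics.QuantumFieldTheory Literature.MathematicalPhysics.QuantumLattice
open Summit.QuantumFields.YangMills.Cruxes.IR.Tempered (cellEdges windowCells regionEdges)
open Summit.QuantumFields.YangMills.Cruxes.IR.CellTempered.Engine (shiftFrame shiftFrame_mesh cellEdges_shiftFrame)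
open Summit.QuantumFields.YangMills.Cruxes.IR.FixedMesh (ClauseI)
open Summit.QuantumFields.YangMills.Cruxes.IR.OnsetFormatsUc (IsFrame TypLocal ClauseIAll ClauseIIukp ClauseIII
  TypShellCondUKPc OnsetMixingTypicalUKPc)
open Summit.QuantumFields.YangMills.Theorems.OddTorusChessboard (cellSites grid_monotone)
open Summit.QuantumFields.YangMills.Theorems.IRRarityUpgrade (supJointRarity_of_supCellRarity
  torusJointRarity_of_supCellRarity)
open Summit.QuantumFields.YangMills.Theorems.IRKernelLargeField (diluteTyp supCellRarity_diluteTyp measurableSet_diluteTyp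
  dependsOn_diluteTyp)
open Summit.QuantumFields.YangMills.Theorems.IRTypLocalExcess (FrameCovariant frameCovariant_inter diluteTyp_shiftFrame
  TypLxInt WorkingClass frameCovariant_workingClass typLocal_workingClass)

namespace Summit.QuantumFields.YangMills.Cruxes.IR.AfPincerUc.Supplier

variable {G : Type} [Group G] [TopologicalSpace G] [IsTopologicalGroup G] [CompactSpace G]
  [MeasurableSpace G] [BorelSpace G]

/-! ## §1 Single-cell any-exterior rarity (crux-plan §B, verbatim shape) -/

/-- **Single-cell ANY-EXTERIOR rarity** of the family `Typ` at budget `δ` on the frame `w`: for every cell `c` and EVERY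
exterior `ζ`, the kernel resampling the cell makes it atypical with probability `≤ δ` (target (A′) of the line). -/
def SupCellRarityAt {N : ℕ} (ρ : G →* Matrix (Fin N) (Fin N) ℂ) (β : ℝ) (w : Fin 4 → ℤ → ℤ)
    (Typ : (Fin 4 → ℤ) → Set (LGConfig 4 G)) (δ : ℝ) : Prop :=
  ∀ (c : Fin 4 → ℤ) (ζ : LGConfig 4 G), (ymSpecification ρ β (regionEdges w {c}) ζ) (Typ c)ᶜ ≤ ENNReal.ofReal δ

/-- Budget monotonicity of single-cell rarity. -/
theorem supCellRarityAt_mono_budget {N : ℕ} {ρ : G →* Matrix (Fin N) (Fin N) ℂ} {β : ℝ} {w : Fin 4 → ℤ → ℤ}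
    {Typ : (Fin 4 → ℤ) → Set (LGConfig 4 G)} {δ δ' : ℝ} (h : δ ≤ δ') (hT : SupCellRarityAt ρ β w Typ δ) :
    SupCellRarityAt ρ β w Typ δ' :=
  fun c ζ => (hT c ζ).trans (ENNReal.ofReal_le_ofReal h)

/-- Single-cell rarity of an intersection: budgets add (union bound). -/
theorem supCellRarityAt_inter {N : ℕ} {ρ : G →* Matrix (Fin N) (Fin N) ℂ} {β : ℝ} {w : Fin 4 → ℤ → ℤ}
    {A B : (Fin 4 → ℤ) → Set (LGConfig 4 G)} {δA δB : ℝ} (hδA : 0 ≤ δA) (hδB : 0 ≤ δB)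
    (hA : SupCellRarityAt ρ β w A δA) (hB : SupCellRarityAt ρ β w B δB) :
    SupCellRarityAt ρ β w (fun c => A c ∩ B c) (δA + δB) := by
  intro c ζ
  rw [Set.compl_inter, ENNReal.ofReal_add hδA hδB]
  exact (measure_union_le _ _).trans (add_le_add (hA c ζ) (hB c ζ))

/-! ## §2 Frames and covariance: clause (i) at every centre is free for covariant families (crux-plan §B) -/

omit [TopologicalSpace G] [IsTopologicalGroup G] [CompactSpace G] [MeasurableSpace G] [BorelSpace G] in
/-- Shifted frames are frames of the same mesh (tree `shiftFrame_mesh`). -/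
theorem isFrame_shiftFrame {b : ℕ} {w : Fin 4 → ℤ → ℤ} (hw : IsFrame b w) (x : Fin 4 → ℤ) :
    IsFrame b (shiftFrame w x) :=
  shiftFrame_mesh hw x

/-- **Clause (i) at every centre is free for covariant suppliers.**  A frame-covariant family with clause (i) at the
centre cell `0` on EVERY mesh-`b` frame has `ClauseIAll` on every mesh-`b` frame. -/
theorem clauseIAll_of_covariant {N : ℕ} (ρ : G →* Matrix (Fin N) (Fin N) ℂ) (β : ℝ) {b : ℕ} (n : ℕ) (ε : ℝ)
    {Typ : (Fin 4 → ℤ → ℤ) → (Fin 4 → ℤ) → Set (LGConfig 4 G)} (hcov : FrameCovariant Typ)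
    (h : ∀ w : Fin 4 → ℤ → ℤ, IsFrame b w → ClauseI ρ β w n ε (Typ w))
    {w : Fin 4 → ℤ → ℤ} (hw : IsFrame b w) : ClauseIAll ρ β w n ε (Typ w) := by
  intro c₀
  have hTyp : (fun c => Typ w (c + c₀)) = Typ (shiftFrame w c₀) := funext fun c => (hcov w c₀ c).symm
  show ClauseI ρ β (shiftFrame w c₀) n ε (fun c => Typ w (c + c₀))
  rw [hTyp]
  exact h (shiftFrame w c₀) (isFrame_shiftFrame hw c₀)

/-! ## §3 ARCH-AE: format Uc from clause (i) and single-cell any-exterior rarity (crux-plan §C) -/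

section ArchAE

variable [T2Space G] [SecondCountableTopology G]

/-- **ARCH-AE adapter for format Uc.**  Per mesh-`b` frame: a measurable cell-local class with `ClauseIAll` and
single-cell ANY-EXTERIOR rarity `δ` gives `TypShellCondUKPc` — (ii)-UKP by the tree's `supJointRarity_of_supCellRarity`
(its radius-1 premiss is not even needed), (iii) by `torusJointRarity_of_supCellRarity`, with the same `δ`. -/
theorem typShellCondUKPc_of_clauseIAll_supCellRarity {N : ℕ} {ρ : G →* Matrix (Fin N) (Fin N) ℂ} (hρ : Continuous ρ)
    (β : ℝ) {b n : ℕ} (hb : 1 ≤ b) {ε δ : ℝ} (hδ : 0 ≤ δ)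
    (h : ∀ w : Fin 4 → ℤ → ℤ, IsFrame b w →
        ∃ Typ : (Fin 4 → ℤ) → Set (LGConfig 4 G),
          TypLocal w Typ ∧ ClauseIAll ρ β w n ε Typ ∧ SupCellRarityAt ρ β w Typ δ) :
    TypShellCondUKPc ρ β b n ε δ := by
  intro w hw
  obtain ⟨Typ, ⟨hm, hd⟩, hi, h1⟩ := h w hw
  have hw' : ∀ i j, w i j + ((b : ℕ) : ℤ) ≤ w i (j + 1) ∧ w i (j + 1) ≤ w i j + 2 * ((b : ℕ) : ℤ) := hw
  refine ⟨Typ, ⟨hm, hd⟩, hi, ?_, ?_⟩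
  · intro F F' hFF' _ ζ _
    exact supJointRarity_of_supCellRarity ρ hρ β (grid_monotone hw') hm hd hδ h1 F F' hFF' ζ
  · exact torusJointRarity_of_supCellRarity ρ hρ β hb hw' hm hd hδ h1

/-- **Covariant-supplier form.**  A frame-covariant family, cell-local and measurable on every frame, with clause (i)
AT THE CENTRE ONLY and any-exterior rarity `δ` on every mesh-`b` frame gives `TypShellCondUKPc`: the extra demand of
format Uc over format U ((i) at every centre) costs a covariant supplier nothing. -/
theorem typShellCondUKPc_of_covariant_supCellRarity {N : ℕ} {ρ : G →* Matrix (Fin N) (Fin N) ℂ} (hρ : Continuous ρ)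
    (β : ℝ) {b n : ℕ} (hb : 1 ≤ b) {ε δ : ℝ} (hδ : 0 ≤ δ)
    {Typ : (Fin 4 → ℤ → ℤ) → (Fin 4 → ℤ) → Set (LGConfig 4 G)} (hcov : FrameCovariant Typ)
    (h : ∀ w : Fin 4 → ℤ → ℤ, IsFrame b w →
        TypLocal w (Typ w) ∧ ClauseI ρ β w n ε (Typ w) ∧ SupCellRarityAt ρ β w (Typ w) δ) :
    TypShellCondUKPc ρ β b n ε δ :=
  typShellCondUKPc_of_clauseIAll_supCellRarity hρ β hb hδ fun w hw =>
    ⟨Typ w, (h w hw).1, clauseIAll_of_covariant ρ β n ε hcov (fun w' hw' => (h w' hw').2.1) hw, (h w hw).2.2⟩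

/-! ## §4 The dilute tier's instance (crux-plan §C; large-field half = tree `supCellRarity_diluteTyp`) -/

/-- The dilute tier has any-exterior single-cell rarity with the explicit budget of `supCellRarity_diluteTyp`. -/
theorem supCellRarityAt_diluteTyp {N : ℕ} {ρ : G →* Matrix (Fin N) (Fin N) ℂ} (hρ : Continuous ρ)
    (hU : ∀ g, ρ g ∈ Matrix.unitaryGroup (Fin N) ℂ) {β : ℝ} (hβ : 0 ≤ β) {b : ℕ} {w : Fin 4 → ℤ → ℤ}
    (hw : IsFrame b w) {ℓ : ℕ} (hℓ : 1 ≤ ℓ) {r m : ℝ} (hm : 0 < m)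
    (hball : ENNReal.ofReal m ≤ haarProbability G {g : G | ‖ρ g - 1‖ ≤ r}) (T : ℝ) :
    SupCellRarityAt ρ β w (diluteTyp ρ w ℓ T)
      ((2 * b : ℝ) ^ 4 * (Real.exp (β * (48 * r ^ 2 * (ℓ : ℝ) ^ 4 + 192 * N * (ℓ : ℝ) ^ 3) - β * T) /
        m ^ (4 * ℓ ^ 4))) :=
  fun c ζ => supCellRarity_diluteTyp ρ hρ hU hβ hw hℓ hm hball T c ζ

/-- **For the dilute tier alone, format Uc = clause (i) at the centre on every frame** once the dilute budget is `≤ δ`. -/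
theorem typShellCondUKPc_dilute_of_clauseI {N : ℕ} {ρ : G →* Matrix (Fin N) (Fin N) ℂ} (hρ : Continuous ρ)
    (hU : ∀ g, ρ g ∈ Matrix.unitaryGroup (Fin N) ℂ) {β : ℝ} (hβ : 0 ≤ β) {b n : ℕ} (hb : 1 ≤ b) {ε δ : ℝ}
    {ℓ : ℕ} (hℓ : 1 ≤ ℓ) {r m : ℝ} (hm : 0 < m)
    (hball : ENNReal.ofReal m ≤ haarProbability G {g : G | ‖ρ g - 1‖ ≤ r}) (T : ℝ)
    (hbudget : (2 * b : ℝ) ^ 4 * (Real.exp (β * (48 * r ^ 2 * (ℓ : ℝ) ^ 4 + 192 * N * (ℓ : ℝ) ^ 3) - β * T) /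
        m ^ (4 * ℓ ^ 4)) ≤ δ)
    (hI : ∀ w : Fin 4 → ℤ → ℤ, IsFrame b w → ClauseI ρ β w n ε (diluteTyp ρ w ℓ T)) :
    TypShellCondUKPc ρ β b n ε δ := by
  have hδ : 0 ≤ δ := le_trans (by positivity) hbudget
  refine typShellCondUKPc_of_covariant_supCellRarity hρ β hb hδ (Typ := fun w c => diluteTyp ρ w ℓ T c)
    (fun w x c => diluteTyp_shiftFrame ρ w x ℓ T c) fun w hw => ⟨?_, hI w hw, ?_⟩
  · exact ⟨measurableSet_diluteTyp ρ hρ w ℓ T, dependsOn_diluteTyp ρ w ℓ T⟩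
  · exact supCellRarityAt_mono_budget hbudget (supCellRarityAt_diluteTyp hρ hU hβ hw hℓ hm hball T)

/-! ## §5 The working class `diluteTyp ∩ Typ_lx^int` packaged for the adapter -/

omit [T2Space G] in
/-- The working class is a `TypLocal` witness on every frame (tree `typLocal_workingClass`, re-bracketed to the
slot's `TypLocal`). -/
theorem typLocal_workingClass' {N : ℕ} {ρ : G →* Matrix (Fin N) (Fin N) ℂ} (hρ : Continuous ρ) (ℓ : ℕ) (T : ℝ)
    (Rs : Set ℕ) (E : ℕ → ℝ) (w : Fin 4 → ℤ → ℤ) : TypLocal w (WorkingClass ρ ℓ T Rs E w) :=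
  typLocal_workingClass ρ hρ ℓ T Rs E w

/-- **Format Uc for the working class from clause (i) at the centre and its single-cell rarity.**  On mesh `b ≥ 1`:
if on every mesh-`b` frame the working class has clause (i) at the centre and any-exterior single-cell rarity `δ ≥ 0`,
then `TypShellCondUKPc ρ β b n ε δ` (witness family = the working class itself; covariance by
`frameCovariant_workingClass`). -/
theorem typShellCondUKPc_workingClass {N : ℕ} {ρ : G →* Matrix (Fin N) (Fin N) ℂ} (hρ : Continuous ρ) (β : ℝ)
    {b n : ℕ} (hb : 1 ≤ b) {ε δ : ℝ} (hδ : 0 ≤ δ) (ℓ : ℕ) (T : ℝ) (Rs : Set ℕ) (E : ℕ → ℝ)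
    (hI : ∀ w : Fin 4 → ℤ → ℤ, IsFrame b w → ClauseI ρ β w n ε (WorkingClass ρ ℓ T Rs E w))
    (hR : ∀ w : Fin 4 → ℤ → ℤ, IsFrame b w → SupCellRarityAt ρ β w (WorkingClass ρ ℓ T Rs E w) δ) :
    TypShellCondUKPc ρ β b n ε δ :=
  typShellCondUKPc_of_covariant_supCellRarity hρ β hb hδ (frameCovariant_workingClass ρ ℓ T Rs E)
    fun w hw => ⟨typLocal_workingClass' hρ ℓ T Rs E w, hI w hw, hR w hw⟩

end ArchAE

/-! ## §6 The reduction of record for `stub_onsetUc`: `OnsetMixingTypicalUKPc ⇐` «(i) at the centre + (A′)» -/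

/-- **«Clause (i) and single-cell rarity at the onset»** — the supplier-side content of `stub_onsetUc` after the
adapter: for every compact simple `G` and lattice representation `r`, admissible `(n, ε)` (`ε · shellCount n ≤ 3/4`)
and, for every budget `δ > 0` and all large `β`, SOME mesh `b ≥ 1` and SOME frame-covariant family, cell-local and
measurable on every mesh-`b` frame, with (b) clause (i) at the centre and (a) any-exterior single-cell rarity `δ` on
every mesh-`b` frame.  (b) is the crux's research content (mixing at a β-dependent mesh `b(β) → ∞`); (a) is (A′). -/
def ClauseIAndRarityAtOnset : Prop :=
  ∀ (G : Type) [Group G] [TopologicalSpace G] [IsTopologicalGroup G] [CompactSpace G],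
    IsCompactSimpleLieGroup G → letI : MeasurableSpace G := borel G; haveI : BorelSpace G := ⟨rfl⟩;
    ∀ r : LatticeRep G, ∃ (n : ℕ) (ε : ℝ), 1 ≤ n ∧ 0 ≤ ε ∧ ε * OnsetFormats.shellCount n ≤ 3 / 4 ∧
      ∀ δ : ℝ, 0 < δ → ∃ β₂ : ℝ, ∀ β : ℝ, β₂ ≤ β → ∃ b : ℕ, 1 ≤ b ∧
        ∃ Typ : (Fin 4 → ℤ → ℤ) → (Fin 4 → ℤ) → Set (LGConfig 4 G), FrameCovariant Typ ∧
          ∀ w : Fin 4 → ℤ → ℤ, IsFrame b w →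
            TypLocal w (Typ w) ∧ ClauseI r.ρ β w n ε (Typ w) ∧ SupCellRarityAt r.ρ β w (Typ w) δ

/-- **REDUCTION OF RECORD (PROVED): `ClauseIAndRarityAtOnset → OnsetMixingTypicalUKPc`** (the tree mirror
`OnsetFormatsUc.OnsetMixingTypicalUKPc` of the registered stub `stub_onsetUc`'s statement, slot :266 verbatim; the slot's
`AfPincerUc.OnsetMixingTypicalUKPc` unfolds to it definitionally once the format module re-exports the clauses).  Hausdorff
and second countability of `G` come from the faithful representation `r`; the rest is
`typShellCondUKPc_of_covariant_supCellRarity`. -/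
theorem onsetMixingTypicalUKPc_of_clauseI_supCellRarity (h : ClauseIAndRarityAtOnset) : OnsetMixingTypicalUKPc := by
  intro G _ _ _ _ hG
  letI : MeasurableSpace G := borel G
  haveI : BorelSpace G := ⟨rfl⟩
  intro r
  haveI : T2Space G := T2Space.of_injective_continuous r.injective r.continuous
  haveI : SecondCountableTopology G :=
    (r.continuous.isClosedEmbedding r.injective).isEmbedding.secondCountableTopology
  obtain ⟨n, ε, hn, hε, hM, hrest⟩ := h G hG r
  refine ⟨n, ε, hn, hε, hM, fun δ hδ => ?_⟩
  obtain ⟨β₂, hβ⟩ := hrest δ hδ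
  refine ⟨β₂, fun β hb => ?_⟩
  obtain ⟨b, hb1, Typ, hcov, hw⟩ := hβ β hb
  exact ⟨b, hb1, typShellCondUKPc_of_covariant_supCellRarity r.continuous β hb1 hδ.le hcov hw⟩

/-- The same reduction, specialised to the WORKING CLASS `diluteTyp ∩ Typ_lx^int` with β-dependent parameters
`ℓ, T, Rs, E` chosen by the supplier: clause (i) at the centre + single-cell rarity `δ` for the working class on every
mesh-`b(β)` frame, for all large `β`, gives `OnsetMixingTypicalUKPc`. -/
theorem onsetMixingTypicalUKPc_of_workingClass
    (h : ∀ (G : Type) [Group G] [TopologicalSpace G] [IsTopologicalGroup G] [CompactSpace G],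
      IsCompactSimpleLieGroup G → letI : MeasurableSpace G := borel G; haveI : BorelSpace G := ⟨rfl⟩;
      ∀ r : LatticeRep G, ∃ (n : ℕ) (ε : ℝ), 1 ≤ n ∧ 0 ≤ ε ∧ ε * OnsetFormats.shellCount n ≤ 3 / 4 ∧
        ∀ δ : ℝ, 0 < δ → ∃ β₂ : ℝ, ∀ β : ℝ, β₂ ≤ β → ∃ b : ℕ, 1 ≤ b ∧
          ∃ (ℓ : ℕ) (T : ℝ) (Rs : Set ℕ) (E : ℕ → ℝ), ∀ w : Fin 4 → ℤ → ℤ, IsFrame b w →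
            ClauseI r.ρ β w n ε (WorkingClass r.ρ ℓ T Rs E w) ∧
              SupCellRarityAt r.ρ β w (WorkingClass r.ρ ℓ T Rs E w) δ) :
    OnsetMixingTypicalUKPc := by
  refine onsetMixingTypicalUKPc_of_clauseI_supCellRarity fun G _ _ _ _ hG => ?_
  letI : MeasurableSpace G := borel G
  haveI : BorelSpace G := ⟨rfl⟩
  intro r
  haveI : T2Space G := T2Space.of_injective_continuous r.injective r.continuous
  haveI : SecondCountableTopology G :=
    (r.continuous.isClosedEmbedding r.injective).isEmbedding.secondCountableTopology
  obtain ⟨n, ε, hn, hε, hM, hrest⟩ := h G hG r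
  refine ⟨n, ε, hn, hε, hM, fun δ hδ => ?_⟩
  obtain ⟨β₂, hβ⟩ := hrest δ hδ
  refine ⟨β₂, fun β hb => ?_⟩
  obtain ⟨b, hb1, ℓ, T, Rs, E, hw⟩ := hβ β hb
  exact ⟨b, hb1, WorkingClass r.ρ ℓ T Rs E, frameCovariant_workingClass r.ρ ℓ T Rs E,
    fun w hw' => ⟨typLocal_workingClass r.ρ r.continuous ℓ T Rs E w, hw w hw'⟩⟩

end Summit.QuantumFields.YangMills.Cruxes.IR.AfPincerUc.Supplier

end
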